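import Literature.NumberTheory.Automorphic.CDTTheorem712TwoLiftsProofs
import HarnessLib

/-!
# BCDT Theorems B and A from ONE weight-two modularity lifting statement at `p = 3`

Topic `NumberTheory/Automorphic`; a `…Proofs` companion (theorems only: no definitions, no named
facts, no instances, no `sorry`) of `Literature.NumberTheory.Automorphic.BCDTModularity` /
`BCDTTheoremB` / `CDTTheorem712TwoLiftsProofs` for the Modularity Theorem
`Literature.NumberTheory.EllipticCurves.ModularForms.exists_isNewformOf` (Breuil–Conrad–Diamond–
Taylor 2001, Thm. A).

`CDTTheorem712TwoLiftsProofs` carries the `3`-adic input of the CDT–BCDT proof as the printed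
lifting statement `lift₃` of CDT 1999, p. 553, **with the hypothesis `27 ∤ N_E`** (Thm. 7.1.1 at
`ℓ = 3` needs a tame type at `3`), so that the wild curves `27 ∣ N_E` still require BCDT's Theorem
2.2.1, cases 2–6 (`exists_isTorsionGaloisRep_and_isModular_of_not_isTamelyRamifiedAbove`, §§3–9 of
BCDT).  Since Kisin, *Moduli of finite flat group schemes, and modularity*, Ann. of Math. 170
(2009) — Theorem of the Introduction (p. 1086) and Cor. 3.5.8 (p. 1172): for `p > 2` and
`ρ : G_{ℚ,S} → GL₂(𝒪)` potentially Barsotti–Tate at `p` with cyclotomic determinant, `ρ̄` modular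
and `ρ̄|_{ℚ(√±p)}` absolutely irreducible, `ρ` is modular, "especially for elliptic curves which
acquire good reduction over a wildly ramified extension of `ℚ₃`" — the lifting statement holds
WITHOUT any condition at `3`.  This file therefore carries, as the hypothesis `hlift3` (no named
fact is introduced, D-0026; same conventions as `CDT_theorem_7_2_1`),

  LIFT(3): for every elliptic `W/ℚ` and framed model `ρ̄` of `E[3]`,
    `ρ̄|_{ℚ(√-3)}` absolutely irreducible → `ρ̄` modular → `E` modular (`IsModular W`),

i.e. `CDT_theorem_7_2_1` with `¬ 27 ∣ N_E` deleted and residual modularity explicit (in print: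
Kisin 2009 Cor. 3.5.8 for `E` potentially good at `3` — all wild cases; CDT Thm. 7.2.1 / Diamond
1996 Thm. 5.4 for `E` potentially multiplicative at `3`, where `27 ∤ N_E`; uniformly
Dieulefait–Pacetti 2023 Thm. 1.4 at `p = 3`, `k = 2`, with Tung 2021 Thm. 4.5; "`ρ_{E,3}` modular ⇒
`E` modular" being BCDT's (3) ⇒ (2), Carayol–Faltings, as in `CDT_theorem_7_2_1`), and shows that
together with "`E[3]` absolutely irreducible ⇒ `ρ̄_{E,3}` modular" (`hmod3`, Langlands–Tunnell:
`modThree_of_langlands_tunnell`) it REPLACES both `CDT_theorem_7_2_1` and the wild fact: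

* `exists_isTorsionGaloisRep_and_isModular_of_modThree_of_liftThree_of_auxiliaryCurve` — every
  absolutely irreducible `ρ̄ : Γ_ℚ → GL₂(𝔽₅)` with cyclotomic determinant is `E[5]` for a MODULAR
  elliptic curve, from `hmod3`, LIFT(3) and the Shepherd-Barron–Taylor auxiliary curve — with no
  tame/wild distinction above `3`; hence `theoremB_of_modThree_of_liftThree_of_auxiliaryCurve`
  (BCDT Theorem B) and `wild_of_modThree_of_liftThree_of_auxiliaryCurve` (the wild fact itself);
* `CDT_theorem_7_2_1_of_modThree_of_liftThree` — CDT Thm. 7.2.1 (its `27 ∤ N_E` unused);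
* `exists_isNewformOf_of_modThree_of_liftThree_of_CDT722_of_switch_of_CDT723` — **Theorem A from
  five inputs**: `hmod3`, LIFT(3), CDT Thm. 7.2.2, the `3`–`5` switch in torsion-only form, CDT
  Lemma 7.2.3 (modularity) — Wiles' case analysis in CDT's p. 556 order with NO conductor
  hypothesis, no Ogg formula and no conductor transfer;
  `exists_isNewformOf_of_langlands_tunnell_of_liftThree_of_CDT722_of_auxiliaryCurve_of_CDT723` —
  the same on the catalogued facts `langlands_tunnell`, `CDT_theorem_7_2_2`,
  `exists_isTorsionGaloisRep_five_and_surjective_three`, `CDT_lemma_7_2_3_isModular`;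
* `exists_isNewformOf_iff_liftThree_of_langlands_tunnell_of_CDT722_of_auxiliaryCurve_of_CDT723` —
  **granted those four catalogued facts, the Modularity Theorem is EQUIVALENT to LIFT(3).**

Trust base of `exists_isNewformOf` along this road: {`langlands_tunnell`, LIFT(3),
`CDT_theorem_7_2_2`, `exists_isTorsionGaloisRep_five_and_surjective_three`,
`CDT_lemma_7_2_3_isModular`}.

## References

* [KisinModuli2009] M. Kisin, Ann. of Math. 170 (2009), 1085–1180: Theorem (p. 1086), Cor. 3.5.8.
* [DieulefaitPacetti2023] Thm. 1.4; [Tung2021] Thm. 4.5; [Kisin2009] (Fontaine–Mazur for `GL₂`).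
* [ConradDiamondTaylor1999] Thm. 7.2.1, Thm. 7.2.2, Lemma 7.2.3, proof of Thm. 7.1.2 (p. 556);
  [Diamond1996] Thm. 5.4; [BCDTJAMS2001] Thm. A, Thm. 2.2.1 and §2.2.
-/

noncomputable section

open scoped MatrixGroups

namespace Literature.NumberTheory.Automorphic.BCDT

open WeierstrassCurve GaloisRepresentations EllipticCurves.ModularForms

/-- **Every absolutely irreducible `ρ̄ : Γ_ℚ → GL₂(𝔽₅)` with cyclotomic determinant is `E[5]` for a
modular elliptic curve `E/ℚ` — from Langlands–Tunnell (`hmod3`), LIFT(3) (`hlift3`) and the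
Shepherd-Barron–Taylor auxiliary curve, with no tame/wild distinction above `3`.**  Take `E` with
`E[5] ≅ ρ̄` and `ρ̄_{E,3}` surjective (`exists_isTorsionGaloisRep_five_and_surjective_three`); then
`ρ̄_{E,3}|_{ℚ(√-3)}` is absolutely irreducible (`isAbsIrreducibleOverSqrt_neg_three_of_surjective`),
`ρ̄_{E,3}` is modular (`hmod3`), and `E` is modular by LIFT(3).  This is BCDT §2.2 with cases 1–6
merged (Kisin 2009, Cor. 3.5.8 needs no `3`-adic type). [cite: KisinModuli2009, Cor. 3.5.8] -/
theorem exists_isTorsionGaloisRep_and_isModular_of_modThree_of_liftThree_of_auxiliaryCurve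
    (hmod3 : ∀ (W : WeierstrassCurve ℚ) [W.IsElliptic] (ρ : ModPGaloisRep ℚ (ZMod 3) 2),
      W.IsTorsionGaloisRep 3 ρ → FramedRep.IsAbsolutelyIrreducible ρ → ρ.IsModular)
    (hlift3 : ∀ (W : WeierstrassCurve ℚ) [W.IsElliptic] [NeZero (W.conductorNorm ℤ)]
      (ρ : ModPGaloisRep ℚ (ZMod 3) 2), W.IsTorsionGaloisRep 3 ρ →
      ρ.IsAbsIrreducibleOverSqrt (-3) → ρ.IsModular → IsModular W)
    (hE : exists_isTorsionGaloisRep_five_and_surjective_three)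
    (ρ : ModPGaloisRep ℚ (ZMod 5) 2) (hirr : FramedRep.IsAbsolutelyIrreducible ρ)
    (hdet : ∀ σ : Field.absoluteGaloisGroup ℚ,
      Matrix.GeneralLinearGroup.det (ρ σ) = modPCyclotomicCharacterZMod ℚ 5 σ) :
    ∃ (W : WeierstrassCurve ℚ) (_ : W.IsElliptic) (_ : NeZero (W.conductorNorm ℤ)),
      W.IsTorsionGaloisRep 5 ρ ∧ IsModular W := by
  obtain ⟨W, hW, hρ, ρ₃, hρ₃, hsurj⟩ := hE ρ hirr hdet
  haveI : NeZero (W.conductorNorm ℤ) := ⟨(conductorNorm_pos_holds W).ne'⟩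
  have h3 : ρ₃.IsAbsIrreducibleOverSqrt (-3) := isAbsIrreducibleOverSqrt_neg_three_of_surjective ρ₃ hsurj
  exact ⟨W, hW, inferInstance, hρ, hlift3 W ρ₃ hρ₃ h3 (hmod3 W ρ₃ hρ₃ h3.isAbsolutelyIrreducible)⟩

/-- **BCDT Theorem B (= Thm. 2.2.1) from Langlands–Tunnell, LIFT(3) and the auxiliary curve**:
`theoremB_of_exists_isTorsionGaloisRep_and_isModular` (the last sentence of §2.2, proved in
`BCDTTheoremB`) on the previous theorem. [cite: BCDTJAMS2001, Theorem 2.2.1] -/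
theorem theoremB_of_modThree_of_liftThree_of_auxiliaryCurve
    (hmod3 : ∀ (W : WeierstrassCurve ℚ) [W.IsElliptic] (ρ : ModPGaloisRep ℚ (ZMod 3) 2),
      W.IsTorsionGaloisRep 3 ρ → FramedRep.IsAbsolutelyIrreducible ρ → ρ.IsModular)
    (hlift3 : ∀ (W : WeierstrassCurve ℚ) [W.IsElliptic] [NeZero (W.conductorNorm ℤ)]
      (ρ : ModPGaloisRep ℚ (ZMod 3) 2), W.IsTorsionGaloisRep 3 ρ →
      ρ.IsAbsIrreducibleOverSqrt (-3) → ρ.IsModular → IsModular W)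
    (hE : exists_isTorsionGaloisRep_five_and_surjective_three) : theoremB :=
  theoremB_of_exists_isTorsionGaloisRep_and_isModular
    (exists_isTorsionGaloisRep_and_isModular_of_modThree_of_liftThree_of_auxiliaryCurve hmod3 hlift3
      hE)

/-- **The wild case of BCDT Thm. 2.2.1 (§§3–9 of the paper) is implied by Langlands–Tunnell,
LIFT(3) and the auxiliary curve**: the named fact
`exists_isTorsionGaloisRep_and_isModular_of_not_isTamelyRamifiedAbove`, its wildness hypothesis
unused. [cite: KisinModuli2009, Introduction (p. 1086)] -/
theorem wild_of_modThree_of_liftThree_of_auxiliaryCurve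
    (hmod3 : ∀ (W : WeierstrassCurve ℚ) [W.IsElliptic] (ρ : ModPGaloisRep ℚ (ZMod 3) 2),
      W.IsTorsionGaloisRep 3 ρ → FramedRep.IsAbsolutelyIrreducible ρ → ρ.IsModular)
    (hlift3 : ∀ (W : WeierstrassCurve ℚ) [W.IsElliptic] [NeZero (W.conductorNorm ℤ)]
      (ρ : ModPGaloisRep ℚ (ZMod 3) 2), W.IsTorsionGaloisRep 3 ρ →
      ρ.IsAbsIrreducibleOverSqrt (-3) → ρ.IsModular → IsModular W)
    (hE : exists_isTorsionGaloisRep_five_and_surjective_three) :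
    exists_isTorsionGaloisRep_and_isModular_of_not_isTamelyRamifiedAbove :=
  fun ρ hirr hdet _ ↦
    exists_isTorsionGaloisRep_and_isModular_of_modThree_of_liftThree_of_auxiliaryCurve hmod3 hlift3
      hE ρ hirr hdet

/-- **CDT Thm. 7.2.1 is implied by Langlands–Tunnell and LIFT(3)** (its hypothesis `27 ∤ N_E`
unused): the named fact `CDT_theorem_7_2_1`. [cite: ConradDiamondTaylor1999, Thm. 7.2.1] -/
theorem CDT_theorem_7_2_1_of_modThree_of_liftThree
    (hmod3 : ∀ (W : WeierstrassCurve ℚ) [W.IsElliptic] (ρ : ModPGaloisRep ℚ (ZMod 3) 2),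
      W.IsTorsionGaloisRep 3 ρ → FramedRep.IsAbsolutelyIrreducible ρ → ρ.IsModular)
    (hlift3 : ∀ (W : WeierstrassCurve ℚ) [W.IsElliptic] [NeZero (W.conductorNorm ℤ)]
      (ρ : ModPGaloisRep ℚ (ZMod 3) 2), W.IsTorsionGaloisRep 3 ρ →
      ρ.IsAbsIrreducibleOverSqrt (-3) → ρ.IsModular → IsModular W) :
    CDT_theorem_7_2_1 :=
  fun W _ _ ρ hρ hirr _ ↦ hlift3 W ρ hρ hirr (hmod3 W ρ hρ hirr.isAbsolutelyIrreducible)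

/-- **The Modularity Theorem (BCDT Thm. A, `exists_isNewformOf`) from five inputs, with no
conductor hypothesis anywhere** — Wiles' case analysis in the order of Conrad–Diamond–Taylor 1999,
proof of Thm. 7.1.2 (p. 556): `hmod3` ("`E[3]` absolutely irreducible ⇒ `ρ̄_{E,3}` modular",
Langlands–Tunnell), `hlift3` (LIFT(3), Kisin 2009 Cor. 3.5.8), `h722` (CDT Thm. 7.2.2 = LIFT(5)),
`hsw` (the `3`–`5` switch, torsion-only: given `E` none of whose framed `ρ̄_{E,3}` is absolutely
irreducible over `ℚ(√-3)` and `ρ̄ = ρ̄_{E,5}` absolutely irreducible over `ℚ(√5)`, an `E'` with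
`E'[5] ≅ E[5]` and some `ρ̄_{E',3}|_{ℚ(√-3)}` absolutely irreducible), `h723` (CDT Lemma 7.2.3,
modularity conclusion; Elkies).  Proof, for each elliptic `W`: (1) some framed `ρ̄_{E,3}` absolutely
irreducible over `ℚ(√-3)` ⇒ modular by `hmod3` + `hlift3`; (2) else fix `ρ̄ = ρ̄_{E,5}`; if
`ρ̄|_{ℚ(√5)}` is not absolutely irreducible, `h723`; (3) else the switch gives `E'`, modular by (1),
so `ρ̄` is modular (`IsModular.isModular_of_isTorsionGaloisRep''`) and `E` is modular by `h722`.
No `27 ∤ N`, no Ogg formula, no conductor transfer. [cite: ConradDiamondTaylor1999, proof of Thm. 7.1.2 (p. 556)] -/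
theorem exists_isNewformOf_of_modThree_of_liftThree_of_CDT722_of_switch_of_CDT723
    (hmod3 : ∀ (W : WeierstrassCurve ℚ) [W.IsElliptic] (ρ : ModPGaloisRep ℚ (ZMod 3) 2),
      W.IsTorsionGaloisRep 3 ρ → FramedRep.IsAbsolutelyIrreducible ρ → ρ.IsModular)
    (hlift3 : ∀ (W : WeierstrassCurve ℚ) [W.IsElliptic] [NeZero (W.conductorNorm ℤ)]
      (ρ : ModPGaloisRep ℚ (ZMod 3) 2), W.IsTorsionGaloisRep 3 ρ →
      ρ.IsAbsIrreducibleOverSqrt (-3) → ρ.IsModular → IsModular W)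
    (h722 : CDT_theorem_7_2_2)
    (hsw : ∀ (W : WeierstrassCurve ℚ) [W.IsElliptic],
      (∀ ρ₃ : ModPGaloisRep ℚ (ZMod 3) 2, W.IsTorsionGaloisRep 3 ρ₃ →
        ¬ ρ₃.IsAbsIrreducibleOverSqrt (-3)) →
      ∀ (ρ : ModPGaloisRep ℚ (ZMod 5) 2), W.IsTorsionGaloisRep 5 ρ → ρ.IsAbsIrreducibleOverSqrt 5 →
      ∃ (W' : WeierstrassCurve ℚ) (_ : W'.IsElliptic), W'.IsTorsionGaloisRep 5 ρ ∧
        ∃ ρ₃' : ModPGaloisRep ℚ (ZMod 3) 2, W'.IsTorsionGaloisRep 3 ρ₃' ∧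
          ρ₃'.IsAbsIrreducibleOverSqrt (-3))
    (h723 : CDT_lemma_7_2_3_isModular) : exists_isNewformOf := by
  refine exists_isNewformOf_iff.mpr fun W _ _ ↦ ?_
  have key : ∀ (V : WeierstrassCurve ℚ) [V.IsElliptic] [NeZero (V.conductorNorm ℤ)]
      (ρ₃ : ModPGaloisRep ℚ (ZMod 3) 2), V.IsTorsionGaloisRep 3 ρ₃ →
      ρ₃.IsAbsIrreducibleOverSqrt (-3) → IsModular V :=
    fun V _ _ ρ₃ hρ₃ h3 ↦ hlift3 V ρ₃ hρ₃ h3 (hmod3 V ρ₃ hρ₃ h3.isAbsolutelyIrreducible)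
  -- (1) some framed `ρ̄_{E,3}` absolutely irreducible over `ℚ(√-3)`
  by_cases h3 : ∃ ρ₃ : ModPGaloisRep ℚ (ZMod 3) 2,
      W.IsTorsionGaloisRep 3 ρ₃ ∧ ρ₃.IsAbsIrreducibleOverSqrt (-3)
  · obtain ⟨ρ₃, hρ₃, h3i⟩ := h3
    exact key W ρ₃ hρ₃ h3i
  push Not at h3
  -- (2) fix `ρ̄ = ρ̄_{E,5}`; Lemma 7.2.3 if `ρ̄|ℚ(√5)` is not absolutely irreducible
  obtain ⟨ρ, hρ⟩ := W.exists_isTorsionGaloisRep 5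
  by_cases h5 : ρ.IsAbsIrreducibleOverSqrt 5
  swap
  · obtain ⟨ρ₃, hρ₃⟩ := W.exists_isTorsionGaloisRep 3
    exact h723 W ρ hρ h5 ρ₃ hρ₃ (h3 ρ₃ hρ₃)
  -- (3) the `3`–`5` switch
  obtain ⟨W', hW', hρ', ρ₃', hρ₃', h3'⟩ := hsw W h3 ρ hρ h5
  haveI := hW'
  haveI : NeZero (W'.conductorNorm ℤ) := ⟨(conductorNorm_pos_holds W').ne'⟩
  have hE' : IsModular W' := key W' ρ₃' hρ₃' h3'
  exact h722 W ρ hρ h5 (hE'.isModular_of_isTorsionGaloisRep'' hρ')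

/-- **The Modularity Theorem from LIFT(3) and four catalogued named facts**: Langlands–Tunnell
(`langlands_tunnell`, through `modThree_of_langlands_tunnell`), CDT Thm. 7.2.2, the
Shepherd-Barron–Taylor auxiliary curve (which gives the torsion-only switch exactly as in
`CDT_three_five_switch_of_exists_isTorsionGaloisRep_five_and_surjective_three`, the idle
`¬ 27 ∣ N_E` dropped: `ρ̄_{E,5}` is absolutely irreducible with cyclotomic determinant by the Weil
pairing, and a surjective `ρ̄_{E',3}` is absolutely irreducible over `ℚ(√-3)`) and CDT Lemma 7.2.3
(modularity).  Trust base of `exists_isNewformOf` along this road: these four plus LIFT(3).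
[cite: KisinModuli2009, Cor. 3.5.8] -/
theorem exists_isNewformOf_of_langlands_tunnell_of_liftThree_of_CDT722_of_auxiliaryCurve_of_CDT723
    (hLT : ∀ σ : FramedArtinRep ℚ 2, langlands_tunnell σ)
    (hlift3 : ∀ (W : WeierstrassCurve ℚ) [W.IsElliptic] [NeZero (W.conductorNorm ℤ)]
      (ρ : ModPGaloisRep ℚ (ZMod 3) 2), W.IsTorsionGaloisRep 3 ρ →
      ρ.IsAbsIrreducibleOverSqrt (-3) → ρ.IsModular → IsModular W)
    (h722 : CDT_theorem_7_2_2) (hE : exists_isTorsionGaloisRep_five_and_surjective_three)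
    (h723 : CDT_lemma_7_2_3_isModular) : exists_isNewformOf := by
  refine exists_isNewformOf_of_modThree_of_liftThree_of_CDT722_of_switch_of_CDT723
    (modThree_of_langlands_tunnell hLT) hlift3 h722 (fun W _ _ ρ hρ h5 ↦ ?_) h723
  obtain ⟨W', hW', hρ', ρ₃, hρ₃, hsurj⟩ := hE ρ h5.isAbsolutelyIrreducible
    (W.det_eq_modPCyclotomicCharacter_of_isTorsionGaloisRep_holds 5 ρ hρ)
  exact ⟨W', hW', hρ', ρ₃, hρ₃, isAbsIrreducibleOverSqrt_neg_three_of_surjective ρ₃ hsurj⟩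

/-- **Granted Langlands–Tunnell, CDT Thm. 7.2.2, the Shepherd-Barron–Taylor auxiliary curve and
CDT Lemma 7.2.3 (modularity), the Modularity Theorem `exists_isNewformOf` is EQUIVALENT to the
single weight-two lifting statement LIFT(3)** (Kisin 2009, Cor. 3.5.8 at `p = 3` for `ρ_{E,3}`):
`→` is trivial (every curve is modular), `←` is the previous theorem.
[cite: KisinModuli2009, Cor. 3.5.8] -/
theorem exists_isNewformOf_iff_liftThree_of_langlands_tunnell_of_CDT722_of_auxiliaryCurve_of_CDT723
    (hLT : ∀ σ : FramedArtinRep ℚ 2, langlands_tunnell σ)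
    (h722 : CDT_theorem_7_2_2) (hE : exists_isTorsionGaloisRep_five_and_surjective_three)
    (h723 : CDT_lemma_7_2_3_isModular) :
    exists_isNewformOf ↔
      ∀ (W : WeierstrassCurve ℚ) [W.IsElliptic] [NeZero (W.conductorNorm ℤ)]
        (ρ : ModPGaloisRep ℚ (ZMod 3) 2), W.IsTorsionGaloisRep 3 ρ →
        ρ.IsAbsIrreducibleOverSqrt (-3) → ρ.IsModular → IsModular W :=
  ⟨fun h W _ _ _ _ _ _ ↦ exists_isNewformOf_iff.mp h W, fun hlift3 ↦
    exists_isNewformOf_of_langlands_tunnell_of_liftThree_of_CDT722_of_auxiliaryCurve_of_CDT723 hLT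
      hlift3 h722 hE h723⟩

end Literature.NumberTheory.Automorphic.BCDT

end
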